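import Literature.Analysis.FluidPDE.NSRPerturbation
import Literature.Analysis.FluidPDE.NavierStokesReynolds
import HarnessLib

/-!
# Perturbing a Navier–Stokes–Reynolds solution at viscosity `ν`, with the gradient part of the
  perturbation routed into the pressure

Analysis/FluidPDE support file (all results proved), the `ν`-general twin of the abstract step
`Torus.IsNSReynoldsOn.perturb` of `NSRPerturbation` (Cheskidov–Luo 2022, Lemmas 4.5–4.6, there at
viscosity `1`), in the form needed by the intermittent-jet scheme of Buckmaster–Vicol
(EMS Surv. Math. Sci. 6 (2019), §7.5–§7.6): the velocity increment is presented as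

  `w = w' + ∇ζ`   (`w'` a jointly smooth field, `ζ` a jointly smooth scalar; `div w = 0`),

as for `w = w^{(p)} + w^{(c)} + w^{(t)}` with the temporal corrector
`w^{(t)} = -μ⁻¹ ∑ P_H P_{≠0}(a²φ²ψ²ξ)` of BV (7.37), `P_H = Id - ∇Δ⁻¹div` (the gradient part is
`∇ζ`, `ζ = μ⁻¹ ∑ Δ⁻¹ div (a²φ²ψ²ξ)`). Since `νΔw = ν div(∇w' + ∇w'ᵀ) - ν∇(div w') + ν∇Δζ` and
`div w' = -Δζ`, the dissipative term is `ν div (∇w' + ∇w'ᵀ)˚` plus a GRADIENT, which is moved into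
the pressure: no bound on second derivatives of `Δ⁻¹` is ever needed for the viscous term (this is
how the scheme avoids the `L^p`-boundedness of the Leray projector).

Given `(u, P, R)` solving the NSR system with viscosity `ν` on `[0, T] × 𝕋^d` (`Torus.IsNSReynoldsOn`),
and jointly smooth `S₁` (symmetric), `q`, `f` with

  `∂ₜw + div (w ⊗ w) + div R = div S₁ + ∇q + f`   on `[0, T] × 𝕋^d`,   (⋆)

the triple `(u + w, perturbedPressureV, perturbedStressV)` solves the NSR system with viscosity
`ν` on `[0, T]`, where

* `perturbedStressV = S̊₁ + (u ⊗ w + w ⊗ u)˚ - ν (∇w' + ∇w'ᵀ)˚ + ℛ f`;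
* `perturbedPressureV = P - (q + tr(S₁ + u ⊗ w + w ⊗ u)/d - ν tr(∇w' + ∇w'ᵀ)/d - 2νΔζ) + mean`.

## References

* T. Buckmaster, V. Vicol, EMS Surv. Math. Sci. 6 (2019) = arXiv:1901.09023, §7.5.3 (7.37)–(7.38),
  §7.6.1 (7.47)–(7.51). [`BuckmasterVicol2020`]
* A. Cheskidov, X. Luo, Invent. Math. 229 (2022) = arXiv:2009.06596, §4.5 Lemmas 4.5–4.6.
  [`CheskidovLuo2022`]
-/

open MeasureTheory Set Filter Topology
open scoped InnerProductSpace ContDiff ENNReal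

noncomputable section

namespace Literature.Analysis.FluidPDE

namespace Torus

open Literature.Analysis.FunctionSpaces.Torus (proj stLift lift IsSmooth IsContDiff laplacian divergence IsDivFree
  HasZeroMean isSmooth_const isContDiff_const isSmoothSpaceTimeOn_const)

variable {d : Type*} [Fintype d] [DecidableEq d]

/-! ## Two calculus identities -/

section Calculus

/-- **`div (∇v + ∇vᵀ) = Δv + ∇(div v)`** for smooth `v` (no divergence constraint). [folklore] -/
theorem tensorDivergence_symGrad_eq {v : UnitAddTorus d → EuclideanSpace ℝ d} (hv : IsSmooth v) (y : UnitAddTorus d) :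
    tensorDivergence (symGrad v) y = laplacian v y + FunctionSpaces.Torus.gradient (divergence v) y := by
  have h1 : ∀ {f : UnitAddTorus d → EuclideanSpace ℝ d}, IsSmooth f → IsContDiff 1 f := fun hf => hf.isContDiff (by simp)
  have h1' : ∀ {f : UnitAddTorus d → ℝ}, IsSmooth f → IsContDiff 1 f := fun hf => hf.isContDiff (by simp)
  unfold symGrad tensorDivergence
  have hsplit : ∀ j, FunctionSpaces.Torus.partialDeriv j (fun z => FunctionSpaces.Torus.partialDeriv j v z +
      FunctionSpaces.Torus.gradient (fun x => v x j) z) y =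
      FunctionSpaces.Torus.partialDeriv j (FunctionSpaces.Torus.partialDeriv j v) y +
        FunctionSpaces.Torus.partialDeriv j (FunctionSpaces.Torus.gradient fun x => v x j) y := fun j =>
    partialDeriv_add_apply (h1 (hv.partialDeriv j)) (h1 (hv.apply j).gradient) j y
  simp_rw [hsplit]
  rw [Finset.sum_add_distrib, ← FunctionSpaces.Torus.laplacian_eq_sum_partialDeriv_partialDeriv hv]
  congr 1
  ext i
  rw [show (∑ j, FunctionSpaces.Torus.partialDeriv j (FunctionSpaces.Torus.gradient fun x => v x j) y) i =
      ∑ j, FunctionSpaces.Torus.partialDeriv j (FunctionSpaces.Torus.gradient fun x => v x j) y i from by simp [Finset.sum_apply]]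
  have h2 : ∀ j, FunctionSpaces.Torus.partialDeriv j (FunctionSpaces.Torus.gradient fun x => v x j) y i =
      FunctionSpaces.Torus.partialDeriv i (FunctionSpaces.Torus.partialDeriv j fun x => v x j) y := by
    intro j
    rw [← FunctionSpaces.Torus.partialDeriv_apply_coord (h1 (hv.apply j).gradient) j y i]
    have h3 : (fun z => FunctionSpaces.Torus.gradient (fun x => v x j) z i) = FunctionSpaces.Torus.partialDeriv i fun x => v x j :=
      funext fun z => FunctionSpaces.Torus.gradient_apply (h1' (hv.apply j)) z i
    rw [h3, FunctionSpaces.Torus.partialDeriv_comm (hv.apply j)]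
  simp_rw [h2]
  rw [← FunctionSpaces.Torus.partialDeriv_finset_sum Finset.univ (fun j _ => h1' ((hv.apply j).partialDeriv j)),
    FunctionSpaces.Torus.gradient_apply (h1' hv.divergence) y i]
  rfl

/-- **`Δ∇ζ = ∇Δζ`** for smooth scalar `ζ` (coordinates: `∑ᵢ ∂ᵢ∂ᵢ∂ⱼζ = ∂ⱼ ∑ᵢ ∂ᵢ∂ᵢζ`; twin of
`Torus.laplacian_gradient` of `DuchonRobertPressure`, not in this import closure). [folklore] -/
theorem laplacian_gradient' {ζ : UnitAddTorus d → ℝ} (hζ : IsSmooth ζ) (y : UnitAddTorus d) :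
    laplacian (FunctionSpaces.Torus.gradient ζ) y = FunctionSpaces.Torus.gradient (laplacian ζ) y := by
  have h1' : ∀ {f : UnitAddTorus d → ℝ}, IsSmooth f → IsContDiff 1 f := fun hf => hf.isContDiff (by simp)
  have hg : IsSmooth (FunctionSpaces.Torus.gradient ζ) := hζ.gradient
  have eL : laplacian ζ = fun z => ∑ i, FunctionSpaces.Torus.partialDeriv i (FunctionSpaces.Torus.partialDeriv i ζ) z :=
    funext (FunctionSpaces.Torus.laplacian_eq_sum_partialDeriv_partialDeriv hζ)
  rw [FunctionSpaces.Torus.laplacian_eq_sum_partialDeriv_partialDeriv hg]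
  ext j
  rw [show (∑ i, FunctionSpaces.Torus.partialDeriv i (FunctionSpaces.Torus.partialDeriv i (FunctionSpaces.Torus.gradient ζ)) y) j =
      ∑ i, FunctionSpaces.Torus.partialDeriv i (FunctionSpaces.Torus.partialDeriv i (FunctionSpaces.Torus.gradient ζ)) y j from
      by simp [Finset.sum_apply],
    FunctionSpaces.Torus.gradient_apply (h1' hζ.laplacian) y j]
  have hcoord : (fun z => FunctionSpaces.Torus.gradient ζ z j) = FunctionSpaces.Torus.partialDeriv j ζ :=
    funext fun z => FunctionSpaces.Torus.gradient_apply (h1' hζ) z j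
  have e : ∀ i, FunctionSpaces.Torus.partialDeriv i (FunctionSpaces.Torus.partialDeriv i (FunctionSpaces.Torus.gradient ζ)) y j =
      FunctionSpaces.Torus.partialDeriv j (FunctionSpaces.Torus.partialDeriv i (FunctionSpaces.Torus.partialDeriv i ζ)) y := by
    intro i
    rw [← FunctionSpaces.Torus.partialDeriv_apply_coord ((hg.partialDeriv i).isContDiff (by simp)) i y j]
    have e2 : (fun z => FunctionSpaces.Torus.partialDeriv i (FunctionSpaces.Torus.gradient ζ) z j) =
        FunctionSpaces.Torus.partialDeriv i (FunctionSpaces.Torus.partialDeriv j ζ) := by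
      funext z
      rw [← FunctionSpaces.Torus.partialDeriv_apply_coord (hg.isContDiff (by simp)) i z j, hcoord]
    have e3 : FunctionSpaces.Torus.partialDeriv i (FunctionSpaces.Torus.partialDeriv j ζ) =
        FunctionSpaces.Torus.partialDeriv j (FunctionSpaces.Torus.partialDeriv i ζ) := funext (FunctionSpaces.Torus.partialDeriv_comm hζ i j)
    rw [e2, e3, FunctionSpaces.Torus.partialDeriv_comm (hζ.partialDeriv i) i j]
  simp_rw [e]
  rw [← FunctionSpaces.Torus.partialDeriv_finset_sum Finset.univ (fun i _ => ((hζ.partialDeriv i).partialDeriv i).isContDiff (by simp)), eL]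

/-- `div (u + v) = div u + div v` for smooth fields. [folklore] -/
theorem divergence_add' {u v : UnitAddTorus d → EuclideanSpace ℝ d} (hu : IsSmooth u) (hv : IsSmooth v) (y : UnitAddTorus d) :
    divergence (fun z => u z + v z) y = divergence u y + divergence v y := by
  have h1 : ∀ {f : UnitAddTorus d → EuclideanSpace ℝ d}, IsSmooth f → IsContDiff 1 f := fun hf => hf.isContDiff (by simp)
  have huv : IsSmooth (fun z => u z + v z) := hu.add hv
  rw [FunctionSpaces.Torus.divergence_eq_sum_partialDeriv_apply (h1 huv),
    FunctionSpaces.Torus.divergence_eq_sum_partialDeriv_apply (h1 hu), FunctionSpaces.Torus.divergence_eq_sum_partialDeriv_apply (h1 hv),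
    ← Finset.sum_add_distrib]
  refine Finset.sum_congr rfl fun i _ => ?_
  rw [show (fun z => u z + v z) = u + v from rfl, FunctionSpaces.Torus.partialDeriv_add (h1 hu) (h1 hv)]
  rfl

/-- `div ∇ζ = Δζ` for smooth scalar `ζ`. [folklore] -/
theorem divergence_gradient' {ζ : UnitAddTorus d → ℝ} (hζ : IsSmooth ζ) (y : UnitAddTorus d) :
    divergence (FunctionSpaces.Torus.gradient ζ) y = laplacian ζ y := by
  rw [FunctionSpaces.Torus.divergence, FunctionSpaces.Torus.laplacian_eq_sum_partialDeriv_partialDeriv hζ]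
  refine Finset.sum_congr rfl fun i _ => ?_
  congr 1
  funext z
  exact FunctionSpaces.Torus.gradient_apply (hζ.isContDiff (by simp)) z i

/-- `∫ div A = 0` over the torus for a smooth tensor field. [folklore] -/
theorem integral_tensorDivergence_eq_zero' {A : UnitAddTorus d → d → EuclideanSpace ℝ d} (hA : IsSmooth A) :
    ∫ y, tensorDivergence A y = 0 := by
  unfold tensorDivergence
  rw [integral_finsetSum _ fun j _ => ((hA.column j).partialDeriv j).integrable]
  exact Finset.sum_eq_zero fun j _ => FunctionSpaces.Torus.integral_partialDeriv_eq_zero_holds (hA.column j) j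

end Calculus

/-! ## The perturbed triple at viscosity `ν` -/

section Perturb

variable (ν : ℝ) (u w' : ℝ → UnitAddTorus d → EuclideanSpace ℝ d) (ζ P q : ℝ → UnitAddTorus d → ℝ)
  (S₁ : ℝ → UnitAddTorus d → d → EuclideanSpace ℝ d) (f : ℝ → UnitAddTorus d → EuclideanSpace ℝ d)

/-- The full velocity increment `w = w' + ∇ζ`. [cite: BuckmasterVicol2020, §7.5.3 (7.37)] -/
def incr : ℝ → UnitAddTorus d → EuclideanSpace ℝ d := fun t y => w' t y + FunctionSpaces.Torus.gradient (ζ t) y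

/-- **The new Reynolds stress at viscosity `ν`**:
`R₁ = S̊₁ + (u ⊗ w + w ⊗ u)˚ - ν(∇w' + ∇w'ᵀ)˚ + ℛ f`, `w = w' + ∇ζ` (BV (7.48)–(7.51) with the
dissipative term of the gradient part in the pressure). [cite: BuckmasterVicol2020, §7.6.1 (7.48)–(7.51)] -/
def perturbedStressV : ℝ → UnitAddTorus d → d → EuclideanSpace ℝ d :=
  fun t y j => traceless (S₁ t) y j + traceless (linStress (u t) (incr w' ζ t)) y j - ν • traceless (symGrad (w' t)) y j +
    antidivergence (f t) y j

/-- The scalar moved into the pressure: `q + tr(S₁ + u ⊗ w + w ⊗ u)/d - ν tr(∇w' + ∇w'ᵀ)/d - 2νΔζ`. [folklore] -/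
def pressureShiftV : ℝ → UnitAddTorus d → ℝ :=
  fun t y => q t y + (tensorTrace (S₁ t) y / Fintype.card d + tensorTrace (linStress (u t) (incr w' ζ t)) y / Fintype.card d) -
    (ν * (tensorTrace (symGrad (w' t)) y / Fintype.card d) + 2 * ν * laplacian (ζ t) y)

/-- **The new pressure** `p₁ = P - (shift - mean)`. [cite: BuckmasterVicol2020, §7.6.1 (7.51)] -/
def perturbedPressureV : ℝ → UnitAddTorus d → ℝ :=
  fun t y => P t y - (pressureShiftV ν u w' ζ q S₁ t y - ∫ z, pressureShiftV ν u w' ζ q S₁ t z)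

variable {ν u w' ζ P q S₁ f} {T : ℝ} {R : ℝ → UnitAddTorus d → d → EuclideanSpace ℝ d}

/-- Joint smoothness of `w = w' + ∇ζ`. [folklore] -/
theorem isSmoothSpaceTimeOn_incr {S : Set ℝ} (hS : UniqueDiffOn ℝ S) (hw' : FunctionSpaces.Torus.IsSmoothSpaceTimeOn S w')
    (hζ : FunctionSpaces.Torus.IsSmoothSpaceTimeOn S ζ) : FunctionSpaces.Torus.IsSmoothSpaceTimeOn S (incr w' ζ) :=
  hw'.add (hζ.gradient hS)

/-- Smoothness of the pressure shift. [folklore] -/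
theorem isSmoothSpaceTimeOn_pressureShiftV {S : Set ℝ} (hS' : UniqueDiffOn ℝ S) (hu : FunctionSpaces.Torus.IsSmoothSpaceTimeOn S u)
    (hw' : FunctionSpaces.Torus.IsSmoothSpaceTimeOn S w') (hζ : FunctionSpaces.Torus.IsSmoothSpaceTimeOn S ζ)
    (hq : FunctionSpaces.Torus.IsSmoothSpaceTimeOn S q) (hS : FunctionSpaces.Torus.IsSmoothSpaceTimeOn S S₁) :
    FunctionSpaces.Torus.IsSmoothSpaceTimeOn S (pressureShiftV ν u w' ζ q S₁) := by
  have htr : ∀ {A : ℝ → UnitAddTorus d → d → EuclideanSpace ℝ d}, FunctionSpaces.Torus.IsSmoothSpaceTimeOn S A →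
      FunctionSpaces.Torus.IsSmoothSpaceTimeOn S (fun t x => tensorTrace (A t) x / Fintype.card d) := fun hA =>
    hA.tensorTrace.mul (isSmoothSpaceTimeOn_const (FunctionSpaces.Torus.isSmooth_const _) S)
  have hw := isSmoothSpaceTimeOn_incr hS' hw' hζ
  have h1 : FunctionSpaces.Torus.IsSmoothSpaceTimeOn S (fun t x => ν * (tensorTrace (symGrad (w' t)) x / Fintype.card d)) :=
    (isSmoothSpaceTimeOn_const (FunctionSpaces.Torus.isSmooth_const ν) S).mul (htr (hw'.symGrad hS'))
  have h2 : FunctionSpaces.Torus.IsSmoothSpaceTimeOn S (fun t x => 2 * ν * laplacian (ζ t) x) :=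
    (isSmoothSpaceTimeOn_const (FunctionSpaces.Torus.isSmooth_const (2 * ν)) S).mul (hζ.laplacian hS')
  exact (hq.add ((htr hS).add (htr (hu.linStress hw)))).sub (h1.add h2)

/-- **The perturbation step at viscosity `ν`.** Let `(u, P, R)` solve the Navier–Stokes–Reynolds
system with viscosity `ν` on `[0, T] × 𝕋^d` (`T > 0`, `d ≥ 2`); let `w'` (a field) and `ζ` (a
scalar) be jointly smooth, with `w = w' + ∇ζ` divergence free and of zero mean; and let jointly
smooth `S₁` (symmetric), `q`, `f` satisfy `∂ₜw + div (w ⊗ w) + div R = div S₁ + ∇q + f` on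
`[0, T] × 𝕋^d`. Then `(u + w, perturbedPressureV, perturbedStressV)` solves the NSR system with
viscosity `ν` on `[0, T]` (BV §7.6.1: the decomposition (7.47) of `div R̊_{q+1} - ∇p_{q+1}`).
[cite: BuckmasterVicol2020, §7.6.1 (7.47)–(7.51)] -/
theorem IsNSReynoldsOn.perturb_visc (hd : 2 ≤ Fintype.card d) (hT : 0 < T)
    (h : IsNSReynoldsOn (Icc 0 T) ν u P R)
    (hw' : FunctionSpaces.Torus.IsSmoothSpaceTimeOn (Icc 0 T) w') (hζ : FunctionSpaces.Torus.IsSmoothSpaceTimeOn (Icc 0 T) ζ)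
    (hwdiv : ∀ t ∈ Icc 0 T, IsDivFree (incr w' ζ t))
    (hwmean : ∀ t ∈ Icc 0 T, HasZeroMean (incr w' ζ t))
    (hS : FunctionSpaces.Torus.IsSmoothSpaceTimeOn (Icc 0 T) S₁) (hSsym : ∀ t ∈ Icc 0 T, ∀ y, ∀ i j : d, S₁ t y i j = S₁ t y j i)
    (hq : FunctionSpaces.Torus.IsSmoothSpaceTimeOn (Icc 0 T) q) (hf : FunctionSpaces.Torus.IsSmoothSpaceTimeOn (Icc 0 T) f)
    (hid : ∀ t ∈ Icc 0 T, ∀ y, FunctionSpaces.Torus.timeDerivWithin (Icc 0 T) (incr w' ζ) t y +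
      tensorDivergence (tensorProd (incr w' ζ t) (incr w' ζ t)) y +
      tensorDivergence (R t) y = tensorDivergence (S₁ t) y + FunctionSpaces.Torus.gradient (q t) y + f t y) :
    IsNSReynoldsOn (Icc 0 T) ν (fun t y => u t y + incr w' ζ t y) (perturbedPressureV ν u w' ζ P q S₁)
      (perturbedStressV ν u w' ζ S₁ f) := by
  haveI : Nonempty d := Fintype.card_pos_iff.1 (by omega)
  have hU : UniqueDiffOn ℝ (Icc 0 T) := uniqueDiffOn_Icc hT
  have hc : Convex ℝ (Icc 0 T) := convex_Icc 0 T
  have hint : (interior (Icc 0 T)).Nonempty := by rw [interior_Icc]; exact nonempty_Ioo.2 hT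
  have hu := h.smooth_velocity
  have hw := isSmoothSpaceTimeOn_incr hU hw' hζ
  have hsh := isSmoothSpaceTimeOn_pressureShiftV (ν := ν) hU hu hw' hζ hq hS
  set w := incr w' ζ with hwdef
  -- zero mean of `f`
  have hfmean : ∀ t ∈ Icc 0 T, ∫ y, f t y = 0 := by
    intro t ht
    have hwt : IsSmooth (w t) := hw.isSmooth_slice ht
    have hRt : IsSmooth (R t) := h.smooth_stress.isSmooth_slice ht
    have hSt : IsSmooth (S₁ t) := hS.isSmooth_slice ht
    have hqt : IsSmooth (q t) := hq.isSmooth_slice ht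
    have heq : f t = (FunctionSpaces.Torus.timeDerivWithin (Icc 0 T) w t + tensorDivergence (tensorProd (w t) (w t)) +
        tensorDivergence (R t)) - tensorDivergence (S₁ t) - FunctionSpaces.Torus.gradient (q t) := by
      funext y; simp only [Pi.add_apply, Pi.sub_apply]; rw [hid t ht y]; abel
    have i1 : Integrable (fun y => FunctionSpaces.Torus.timeDerivWithin (Icc 0 T) w t y) volume := ((hw.timeDerivWithin hU).isSmooth_slice ht).integrable
    have i2 : Integrable (tensorDivergence (tensorProd (w t) (w t))) volume := (hwt.tensorProd hwt).tensorDivergence.integrable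
    have i3 : Integrable (tensorDivergence (R t)) volume := hRt.tensorDivergence.integrable
    have i4 : Integrable (tensorDivergence (S₁ t)) volume := hSt.tensorDivergence.integrable
    have i5 : Integrable (FunctionSpaces.Torus.gradient (q t)) volume := hqt.gradient.integrable
    rw [heq, integral_sub' ((((i1.add i2).add i3).sub i4)) i5, integral_sub' ((i1.add i2).add i3) i4,
      integral_add' (i1.add i2) i3, integral_add' i1 i2]
    change (∫ y, FunctionSpaces.Torus.timeDerivWithin (Icc 0 T) w t y) + (∫ y, tensorDivergence (tensorProd (w t) (w t)) y) +
      (∫ y, tensorDivergence (R t) y) - (∫ y, tensorDivergence (S₁ t) y) - (∫ y, FunctionSpaces.Torus.gradient (q t) y) = 0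
    rw [integral_timeDerivWithin_eq_zero hw hc hU hwmean ht, integral_tensorDivergence_eq_zero' (hwt.tensorProd hwt),
      integral_tensorDivergence_eq_zero' hRt, integral_tensorDivergence_eq_zero' hSt, FunctionSpaces.Torus.integral_gradient_eq_zero hqt]
    simp
  refine
    { smooth_velocity := hu.add hw
      smooth_pressure := h.smooth_pressure.sub (hsh.sub (hsh.integral_const hU hc))
      smooth_stress := ?_
      momentum := ?_
      divFree := fun t ht => IsDivFree.add ((hu.isSmooth_slice ht).isContDiff (by simp))
        ((hw.isSmooth_slice ht).isContDiff (by simp)) (h.divFree t ht) (hwdiv t ht)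
      symm := ?_
      traceFree := ?_
      hasZeroMean_pressure := ?_ }
  · -- smoothness of the stress
    have h1 := (hS.traceless).add ((hu.linStress hw).traceless)
    have h3 : FunctionSpaces.Torus.IsSmoothSpaceTimeOn (Icc 0 T) (fun t y j => ν • traceless (symGrad (w' t)) y j) :=
      ((hw'.symGrad hU).traceless).const_smul ν
    exact (h1.sub h3).add (hf.antidivergence hc hint)
  · -- momentum
    intro t ht y
    have hut : IsSmooth (u t) := hu.isSmooth_slice ht
    have hwt : IsSmooth (w t) := hw.isSmooth_slice ht
    have hw't : IsSmooth (w' t) := hw'.isSmooth_slice ht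
    have hζt : IsSmooth (ζ t) := hζ.isSmooth_slice ht
    have hPt : IsSmooth (P t) := h.smooth_pressure.isSmooth_slice ht
    have hSt : IsSmooth (S₁ t) := hS.isSmooth_slice ht
    have hft : IsSmooth (f t) := hf.isSmooth_slice ht
    have hsht : IsSmooth (pressureShiftV ν u w' ζ q S₁ t) := hsh.isSmooth_slice ht
    have h1u : IsContDiff 1 (u t) := hut.isContDiff (by simp)
    have h1w : IsContDiff 1 (w t) := hwt.isContDiff (by simp)
    -- time derivative
    have eDt : FunctionSpaces.Torus.timeDerivWithin (Icc 0 T) (fun t y => u t y + w t y) t y =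
        FunctionSpaces.Torus.timeDerivWithin (Icc 0 T) u t y + FunctionSpaces.Torus.timeDerivWithin (Icc 0 T) w t y :=
      ((hu.hasDerivWithinAt_slice ht y).add (hw.hasDerivWithinAt_slice ht y)).derivWithin (hU t ht)
    -- Laplacians
    have eLap : laplacian (fun y => u t y + w t y) y = laplacian (u t) y + laplacian (w t) y := laplacian_add_apply hut hwt y
    have eLapw : laplacian (w t) y = laplacian (w' t) y + FunctionSpaces.Torus.gradient (laplacian (ζ t)) y := by
      show laplacian (fun y => w' t y + FunctionSpaces.Torus.gradient (ζ t) y) y = _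
      rw [laplacian_add_apply hw't hζt.gradient, laplacian_gradient' hζt]
    -- divergence of `w'`: `div w' = -Δζ`
    have eDivw' : divergence (w' t) = fun y => -laplacian (ζ t) y := by
      funext z
      have h0 := hwdiv t ht z
      have : divergence (w t) z = divergence (w' t) z + divergence (FunctionSpaces.Torus.gradient (ζ t)) z := by
        show divergence (fun y => w' t y + FunctionSpaces.Torus.gradient (ζ t) y) z = _
        exact divergence_add' hw't hζt.gradient z
      rw [this, divergence_gradient' hζt] at h0
      linarith
    -- convective term, pressure gradient
    have eConv : FunctionSpaces.Torus.convect (fun y => u t y + w t y) (fun y => u t y + w t y) y =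
        FunctionSpaces.Torus.convect (u t) (u t) y + FunctionSpaces.Torus.convect (u t) (w t) y +
          (FunctionSpaces.Torus.convect (w t) (u t) y + FunctionSpaces.Torus.convect (w t) (w t) y) := by
      rw [convect_add_left, convect_add_right _ h1u h1w, convect_add_right _ h1u h1w]
    have hshm : IsContDiff 1 (fun y => pressureShiftV ν u w' ζ q S₁ t y - ∫ z, pressureShiftV ν u w' ζ q S₁ t z) :=
      (hsht.sub (FunctionSpaces.Torus.isSmooth_const _)).isContDiff (by simp)
    have eGrad : FunctionSpaces.Torus.gradient (perturbedPressureV ν u w' ζ P q S₁ t) y =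
        FunctionSpaces.Torus.gradient (P t) y - FunctionSpaces.Torus.gradient (pressureShiftV ν u w' ζ q S₁ t) y := by
      have e1 : perturbedPressureV ν u w' ζ P q S₁ t = fun y => P t y + (-1 : ℝ) *
          (pressureShiftV ν u w' ζ q S₁ t y - ∫ z, pressureShiftV ν u w' ζ q S₁ t z) := by
        funext y; simp [perturbedPressureV, sub_eq_add_neg]
      have e2 : (fun y => pressureShiftV ν u w' ζ q S₁ t y - ∫ z, pressureShiftV ν u w' ζ q S₁ t z) =
          fun y => pressureShiftV ν u w' ζ q S₁ t y + (-∫ z, pressureShiftV ν u w' ζ q S₁ t z) := by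
        funext y; rw [sub_eq_add_neg]
      have hm1 : IsContDiff 1 (fun y => (-1 : ℝ) * (pressureShiftV ν u w' ζ q S₁ t y - ∫ z, pressureShiftV ν u w' ζ q S₁ t z)) := by
        have : IsSmooth (fun y => (-1 : ℝ) * (pressureShiftV ν u w' ζ q S₁ t y - ∫ z, pressureShiftV ν u w' ζ q S₁ t z)) :=
          contDiff_const.mul (hsht.sub (FunctionSpaces.Torus.isSmooth_const (∫ z, pressureShiftV ν u w' ζ q S₁ t z)))
        exact this.isContDiff (by simp)
      rw [e1, gradient_add_apply (hPt.isContDiff (by simp)) hm1, gradient_const_mul_apply hshm, e2,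
        gradient_add_apply (hsht.isContDiff (by simp)) (FunctionSpaces.Torus.isContDiff_const _), gradient_const]
      simp [sub_eq_add_neg]
    -- gradient of the shift = the trace/pressure gradients
    have htrS : IsSmooth (fun z => tensorTrace (S₁ t) z / Fintype.card d) := hSt.tensorTrace.div_const _
    have htrL : IsSmooth (fun z => tensorTrace (linStress (u t) (w t)) z / Fintype.card d) :=
      (hut.linStress hwt).tensorTrace.div_const _
    have htrG : IsSmooth (fun z => tensorTrace (symGrad (w' t)) z / Fintype.card d) := hw't.symGrad.tensorTrace.div_const _
    have hV1 : IsSmooth (fun z => ν * (tensorTrace (symGrad (w' t)) z / Fintype.card d)) := contDiff_const.mul htrG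
    have hV2 : IsSmooth (fun z => 2 * ν * laplacian (ζ t) z) := contDiff_const.mul hζt.laplacian
    have eShift : FunctionSpaces.Torus.gradient (pressureShiftV ν u w' ζ q S₁ t) y =
        FunctionSpaces.Torus.gradient (q t) y +
          (FunctionSpaces.Torus.gradient (fun z => tensorTrace (S₁ t) z / Fintype.card d) y +
            FunctionSpaces.Torus.gradient (fun z => tensorTrace (linStress (u t) (w t)) z / Fintype.card d) y) -
          (ν • FunctionSpaces.Torus.gradient (fun z => tensorTrace (symGrad (w' t)) z / Fintype.card d) y +
            (2 * ν) • FunctionSpaces.Torus.gradient (laplacian (ζ t)) y) := by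
      have ePS : pressureShiftV ν u w' ζ q S₁ t = fun y => (q t y + ((fun z => tensorTrace (S₁ t) z / Fintype.card d) y +
          (fun z => tensorTrace (linStress (u t) (w t)) z / Fintype.card d) y)) +
          (-1 : ℝ) * ((fun z => ν * (tensorTrace (symGrad (w' t)) z / Fintype.card d)) y + (fun z => 2 * ν * laplacian (ζ t) z) y) := by
        funext y; simp only [pressureShiftV, hwdef]; ring
      have hsum : IsContDiff 1 (fun y => (fun z => tensorTrace (S₁ t) z / Fintype.card d) y +
          (fun z => tensorTrace (linStress (u t) (w t)) z / Fintype.card d) y) := (htrS.add htrL).isContDiff (by simp)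
      have hsumV : IsContDiff 1 (fun y => (fun z => ν * (tensorTrace (symGrad (w' t)) z / Fintype.card d)) y +
          (fun z => 2 * ν * laplacian (ζ t) z) y) := (hV1.add hV2).isContDiff (by simp)
      have hA : IsContDiff 1 (fun y => q t y + ((fun z => tensorTrace (S₁ t) z / Fintype.card d) y +
          (fun z => tensorTrace (linStress (u t) (w t)) z / Fintype.card d) y)) := ((hq.isSmooth_slice ht).add (htrS.add htrL)).isContDiff (by simp)
      have hB : IsContDiff 1 (fun y => (-1 : ℝ) * ((fun z => ν * (tensorTrace (symGrad (w' t)) z / Fintype.card d)) y +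
          (fun z => 2 * ν * laplacian (ζ t) z) y)) := by
        have : IsSmooth (fun y => (-1 : ℝ) * ((fun z => ν * (tensorTrace (symGrad (w' t)) z / Fintype.card d)) y +
            (fun z => 2 * ν * laplacian (ζ t) z) y)) := contDiff_const.mul (hV1.add hV2)
        exact this.isContDiff (by simp)
      rw [ePS, gradient_add_apply hA hB, gradient_add_apply ((hq.isSmooth_slice ht).isContDiff (by simp)) hsum,
        gradient_add_apply (htrS.isContDiff (by simp)) (htrL.isContDiff (by simp)), gradient_const_mul_apply hsumV,
        gradient_add_apply (hV1.isContDiff (by simp)) (hV2.isContDiff (by simp)),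
        gradient_const_mul_apply (htrG.isContDiff (by simp)), gradient_const_mul_apply (hζt.laplacian.isContDiff (by simp))]
      simp only [smul_add, neg_smul, one_smul]
      abel
    -- divergence of the new stress
    have hT1 : IsSmooth (traceless (S₁ t)) := hSt.traceless
    have hT2 : IsSmooth (traceless (linStress (u t) (w t))) := (hut.linStress hwt).traceless
    have hT3 : IsSmooth (traceless (symGrad (w' t))) := hw't.symGrad.traceless
    have hT4 : IsSmooth (antidivergence (f t)) := isSmooth_antidivergence hft
    have eDiv : tensorDivergence (perturbedStressV ν u w' ζ S₁ f t) y =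
        (tensorDivergence (S₁ t) y - FunctionSpaces.Torus.gradient (fun z => tensorTrace (S₁ t) z / Fintype.card d) y) +
        (FunctionSpaces.Torus.convect (u t) (w t) y + FunctionSpaces.Torus.convect (w t) (u t) y -
          FunctionSpaces.Torus.gradient (fun z => tensorTrace (linStress (u t) (w t)) z / Fintype.card d) y) -
        ν • (laplacian (w' t) y + FunctionSpaces.Torus.gradient (divergence (w' t)) y -
          FunctionSpaces.Torus.gradient (fun z => tensorTrace (symGrad (w' t)) z / Fintype.card d) y) + f t y := by
      have e1 : perturbedStressV ν u w' ζ S₁ f t = fun y j => traceless (S₁ t) y j +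
          (traceless (linStress (u t) (w t)) y j + ((-ν) • traceless (symGrad (w' t)) y j + antidivergence (f t) y j)) := by
        funext y j; simp only [perturbedStressV, neg_smul, hwdef]; abel
      have c1 : IsContDiff 1 (fun y j => (-ν) • traceless (symGrad (w' t)) y j) := (hT3.smul (-ν)).isContDiff (by simp)
      have c2 : IsContDiff 1 (fun y j => (-ν) • traceless (symGrad (w' t)) y j + antidivergence (f t) y j) :=
        c1.add (hT4.isContDiff (by simp))
      have c3 : IsContDiff 1 (fun y j => traceless (linStress (u t) (w t)) y j +
          ((-ν) • traceless (symGrad (w' t)) y j + antidivergence (f t) y j)) := (hT2.isContDiff (n := 1) (by simp)).add c2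
      rw [e1, tensorDivergence_add_apply (hT1.isContDiff (by simp)) c3,
        tensorDivergence_add_apply (hT2.isContDiff (by simp)) c2, tensorDivergence_add_apply c1 (hT4.isContDiff (by simp)),
        tensorDivergence_const_smul_apply (hT3.isContDiff (by simp)), tensorDivergence_traceless hSt,
        tensorDivergence_traceless (hut.linStress hwt), tensorDivergence_traceless hw't.symGrad,
        tensorDivergence_linStress hut hwt (h.divFree t ht) (hwdiv t ht),
        tensorDivergence_symGrad_eq hw't, tensorDivergence_antidivergence hd hft, hfmean t ht]
      simp only [neg_smul, sub_zero]
      abel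
    -- assemble
    have hUeq := h.momentum t ht y
    have hW := hid t ht y
    rw [eDt, eLap, eLapw, eConv, eGrad, eShift, eDiv, eDivw']
    set Du := FunctionSpaces.Torus.timeDerivWithin (Icc 0 T) u t y
    set Dw := FunctionSpaces.Torus.timeDerivWithin (Icc 0 T) w t y
    set Cuu := FunctionSpaces.Torus.convect (u t) (u t) y
    set Cuw := FunctionSpaces.Torus.convect (u t) (w t) y
    set Cwu := FunctionSpaces.Torus.convect (w t) (u t) y
    set Cww := FunctionSpaces.Torus.convect (w t) (w t) y
    set GP := FunctionSpaces.Torus.gradient (P t) y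
    set Gq := FunctionSpaces.Torus.gradient (q t) y
    set G1 := FunctionSpaces.Torus.gradient (fun z => tensorTrace (S₁ t) z / Fintype.card d) y
    set G2 := FunctionSpaces.Torus.gradient (fun z => tensorTrace (linStress (u t) (w t)) z / Fintype.card d) y
    set G3 := FunctionSpaces.Torus.gradient (fun z => tensorTrace (symGrad (w' t)) z / Fintype.card d) y
    set GLz := FunctionSpaces.Torus.gradient (laplacian (ζ t)) y
    set Lu := laplacian (u t) y
    set Lw' := laplacian (w' t) y
    set DR := tensorDivergence (R t) y
    set DS := tensorDivergence (S₁ t) y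
    set F := f t y
    have eGL : FunctionSpaces.Torus.gradient (fun y => -laplacian (ζ t) y) y = -GLz := by
      have : (fun y => -laplacian (ζ t) y) = fun y => (-1 : ℝ) * laplacian (ζ t) y := by funext z; ring
      rw [this, gradient_const_mul_apply (hζt.laplacian.isContDiff (by simp))]; simp [GLz]
    rw [eGL]
    have eww : tensorDivergence (tensorProd (w t) (w t)) y = Cww := by
      rw [tensorDivergence_tensorProd hwt hwt, hwdiv t ht y, zero_smul, add_zero]
    rw [eww] at hW
    -- `hUeq : Du + Cuu + GP = ν • Lu + DR`, `hW : Dw + Cww + DR = DS + Gq + F`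
    have key : Du + Dw + (Cuu + Cuw + (Cwu + Cww)) + (GP - (Gq + (G1 + G2) - (ν • G3 + (2 * ν) • GLz))) -
        (ν • (Lu + (Lw' + GLz)) + (DS - G1 + (Cuw + Cwu - G2) - ν • (Lw' + -GLz - G3) + F)) =
        (Du + Cuu + GP - (ν • Lu + DR)) + (Dw + Cww + DR - (DS + Gq + F)) := by
      simp only [smul_add, smul_sub, smul_neg, mul_smul, two_smul]
      abel
    rw [hUeq, hW, sub_self, sub_self, add_zero, sub_eq_zero] at key
    exact key
  · -- symmetry
    intro t ht y i j
    have h1w : IsContDiff 1 (w t) := (hw.isSmooth_slice ht).isContDiff (by simp)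
    have h1w' : IsContDiff 1 (w' t) := (hw'.isSmooth_slice ht).isContDiff (by simp)
    simp only [perturbedStressV, ← hwdef, PiLp.add_apply, PiLp.sub_apply, PiLp.smul_apply]
    rw [traceless_symm (hSsym t ht y) i j, traceless_symm (fun i j => linStress_symm (u t) (w t) y i j) i j,
      traceless_symm (fun i j => symGrad_symm h1w' y i j) i j, antidivergence_symm (hf.isSmooth_slice ht) y j i]
  · -- trace
    intro t ht y
    simp only [perturbedStressV, ← hwdef, PiLp.add_apply, PiLp.sub_apply, PiLp.smul_apply, smul_eq_mul, Finset.sum_add_distrib,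
      Finset.sum_sub_distrib, ← Finset.mul_sum, sum_traceless_apply_apply, antidivergence_trace hd (hf.isSmooth_slice ht)]
    simp
  · -- zero mean of the pressure
    intro t ht
    have hsht : IsSmooth (pressureShiftV ν u w' ζ q S₁ t) := hsh.isSmooth_slice ht
    have z1 : HasZeroMean (fun y => pressureShiftV ν u w' ζ q S₁ t y - ∫ z, pressureShiftV ν u w' ζ q S₁ t z) :=
      hasZeroMean_sub_integral hsht.integrable
    exact HasZeroMean.sub (h.hasZeroMean_pressure t ht) z1 (h.smooth_pressure.isSmooth_slice ht).integrable
      (hsht.sub (FunctionSpaces.Torus.isSmooth_const _)).integrable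

/-- **Pointwise size of the new stress**:
`‖R₁‖ ≤ 2‖S₁‖ + 4‖u‖‖w‖ + 4|ν| ∑ᵢ‖∂ᵢw'‖ + ‖ℛf‖`. [folklore] -/
theorem norm_perturbedStressV_le {t : ℝ} (hw't : IsContDiff 1 (w' t)) (y : UnitAddTorus d) :
    ‖perturbedStressV ν u w' ζ S₁ f t y‖ ≤ 2 * ‖S₁ t y‖ + 4 * ‖u t y‖ * ‖incr w' ζ t y‖ +
      4 * |ν| * ∑ i, ‖FunctionSpaces.Torus.partialDeriv i (w' t) y‖ + ‖antidivergence (f t) y‖ := by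
  have e : perturbedStressV ν u w' ζ S₁ f t y = traceless (S₁ t) y + traceless (linStress (u t) (incr w' ζ t)) y -
      ν • traceless (symGrad (w' t)) y + antidivergence (f t) y := by funext j; simp [perturbedStressV]
  rw [e]
  have h1 := norm_traceless_le (S₁ t) y
  have h2 := (norm_traceless_le (linStress (u t) (incr w' ζ t)) y).trans
    (mul_le_mul_of_nonneg_left (norm_linStress_le (u t) (incr w' ζ t) y) (by norm_num))
  have h3 : ‖ν • traceless (symGrad (w' t)) y‖ ≤ |ν| * (2 * (2 * ∑ i, ‖FunctionSpaces.Torus.partialDeriv i (w' t) y‖)) := by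
    rw [norm_smul, Real.norm_eq_abs]
    exact mul_le_mul_of_nonneg_left ((norm_traceless_le _ y).trans (mul_le_mul_of_nonneg_left (norm_symGrad_le hw't y) (by norm_num)))
      (abs_nonneg _)
  calc ‖traceless (S₁ t) y + traceless (linStress (u t) (incr w' ζ t)) y - ν • traceless (symGrad (w' t)) y + antidivergence (f t) y‖
      ≤ ‖traceless (S₁ t) y + traceless (linStress (u t) (incr w' ζ t)) y - ν • traceless (symGrad (w' t)) y‖ + ‖antidivergence (f t) y‖ :=
        norm_add_le _ _
    _ ≤ ‖traceless (S₁ t) y + traceless (linStress (u t) (incr w' ζ t)) y‖ + ‖ν • traceless (symGrad (w' t)) y‖ +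
          ‖antidivergence (f t) y‖ := by gcongr; exact norm_sub_le _ _
    _ ≤ ‖traceless (S₁ t) y‖ + ‖traceless (linStress (u t) (incr w' ζ t)) y‖ + ‖ν • traceless (symGrad (w' t)) y‖ +
          ‖antidivergence (f t) y‖ := by gcongr; exact norm_add_le _ _
    _ ≤ _ := by nlinarith [abs_nonneg ν, Finset.sum_nonneg (fun i (_ : i ∈ Finset.univ) => norm_nonneg (FunctionSpaces.Torus.partialDeriv i (w' t) y))]

end Perturb

end Torus

end Literature.Analysis.FluidPDE
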